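import Mathlib
import Summits.MatrixMultiplication.MatrixMultiplication.Theses.NOFWindowCapacity

/-!
# Route NOFWindowCapacity — `GapKillsThesis`

The negative horn closes the route: a uniform power saving `η > 0` over the triangle bound for
alien-free windows (`WindowCapacityGap`) is incompatible with the entanglement horn `Thesis`.

Proof (pure real-exponent bookkeeping, no rank facts): put `η₀ := min η (1/2)` and apply `Thesis`
at `ε := η₀`, obtaining `N ≥ 2`, a host `G`, `B` alien-free boxes partitioning the `N³`
matrix-multiplication triples, and `B·|G| ≤ N^{2+η₀}`.  Since the boxes cover all triples,
`N³ ≤ Σ_r cells_r ≤ B · |G|^{3/2-η} ≤ B · |G|^{3/2-η₀}` (as `|G| ≥ 1`), and since `B ≥ 1` and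
`3/2 - η₀ ≥ 1`, `B ≤ B^{3/2-η₀}`, so `N³ ≤ (B·|G|)^{3/2-η₀} ≤ N^{(2+η₀)(3/2-η₀)}`.  But
`(2+η₀)(3/2-η₀) = 3 - η₀/2 - η₀² < 3` and `N ≥ 2`, a contradiction.
-/

namespace Summit.MatrixMultiplication.MatrixMultiplication.Theorems

open Summit.MatrixMultiplication.MatrixMultiplication.Theses.NOFWindowCapacity

/-- **GapKillsThesis** (route NOFWindowCapacity, item stmt-MatrixMultiplication-7279):
a window-capacity gap `cells ≤ |G|^{3/2-η}` for every alien-free box refutes the entanglement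
horn `Thesis` (alien-free box partitions with `B·|G| ≤ N^{2+ε}` for every `ε > 0`). -/
theorem gapKillsThesis_proof : GapKillsThesis := by
  unfold GapKillsThesis
  intro hGap hX
  obtain ⟨η, hη, hgap⟩ := hGap
  -- the working exponent `η₀ = min η (1/2)`
  set η₀ : ℝ := min η (1 / 2) with hη₀_def
  have hη₀pos : 0 < η₀ := lt_min hη (by norm_num)
  have hη₀le : η₀ ≤ η := min_le_left _ _
  have hη₀half : η₀ ≤ 1 / 2 := min_le_right _ _
  obtain ⟨N, hN, G, instG, instF, s, t, u, B, P, Q, R, hAF, hPart, hB⟩ := hX η₀ hη₀pos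
  -- (1) the boxes cover all `N³` triples, so `N³ ≤ Σ_r cells_r`
  have hcover : (Finset.univ : Finset (Fin N × Fin N × Fin N)) ⊆
      Finset.univ.biUnion (fun r : Fin B => Finset.univ.filter
        (fun x : Fin N × Fin N × Fin N =>
          (x.1, x.2.2) ∈ P r ∧ (x.1, x.2.1) ∈ Q r ∧ (x.2.1, x.2.2) ∈ R r)) := by
    rintro ⟨i, j, k⟩ -
    obtain ⟨r, hr, -⟩ := hPart i j k
    simp only [Finset.mem_biUnion, Finset.mem_univ, true_and, Finset.mem_filter]
    exact ⟨r, hr⟩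
  have hcount : N ^ 3 ≤ ∑ r : Fin B, (Finset.univ.filter
        (fun x : Fin N × Fin N × Fin N =>
          (x.1, x.2.2) ∈ P r ∧ (x.1, x.2.1) ∈ Q r ∧ (x.2.1, x.2.2) ∈ R r)).card := by
    calc N ^ 3 = (Finset.univ : Finset (Fin N × Fin N × Fin N)).card := by
          simp only [Finset.card_univ, Fintype.card_prod, Fintype.card_fin]; ring
      _ ≤ _ := Finset.card_le_card hcover
      _ ≤ _ := Finset.card_biUnion_le
  -- (2) `B ≥ 1` (the triple `(0,0,0)` lies in some box) and `|G| ≥ 1`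
  have hB1 : 0 < B :=
    (hPart ⟨0, by omega⟩ ⟨0, by omega⟩ ⟨0, by omega⟩).exists.elim fun r _ => r.pos
  have hB1' : (1 : ℝ) ≤ B := by exact_mod_cast hB1
  have hG1 : (1 : ℝ) ≤ Fintype.card G := by
    exact_mod_cast Fintype.card_pos_iff.mpr ⟨0⟩
  have hN1 : (1 : ℝ) < N := by exact_mod_cast hN
  -- (3) each box obeys the gap bound, with exponent relaxed from `η` to `η₀`
  have hcell : ∀ r : Fin B, ((Finset.univ.filter
        (fun x : Fin N × Fin N × Fin N =>
          (x.1, x.2.2) ∈ P r ∧ (x.1, x.2.1) ∈ Q r ∧ (x.2.1, x.2.2) ∈ R r)).card : ℝ)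
        ≤ (Fintype.card G : ℝ) ^ ((3 : ℝ) / 2 - η₀) := fun r =>
    (hgap N G s t u (P r) (Q r) (R r) (hAF r)).trans
      (Real.rpow_le_rpow_of_exponent_le hG1 (by linarith))
  -- (4) the chain `N³ ≤ B·|G|^{3/2-η₀} ≤ (B|G|)^{3/2-η₀} ≤ N^{(2+η₀)(3/2-η₀)} < N³`
  have hsum : ((N : ℝ)) ^ 3 ≤ (B : ℝ) * (Fintype.card G : ℝ) ^ ((3 : ℝ) / 2 - η₀) := by
    have h1 : ((N ^ 3 : ℕ) : ℝ) ≤ ∑ r : Fin B, ((Finset.univ.filter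
        (fun x : Fin N × Fin N × Fin N =>
          (x.1, x.2.2) ∈ P r ∧ (x.1, x.2.1) ∈ Q r ∧ (x.2.1, x.2.2) ∈ R r)).card : ℝ) := by
      exact_mod_cast hcount
    have h2 := Finset.sum_le_sum fun r (_ : r ∈ (Finset.univ : Finset (Fin B))) => hcell r
    simp only [Finset.sum_const, Finset.card_univ, Fintype.card_fin, nsmul_eq_mul] at h2
    push_cast at h1
    exact h1.trans h2
  have hBG : (B : ℝ) * (Fintype.card G : ℝ) ≤ (N : ℝ) ^ (2 + η₀) := by
    push_cast at hB
    exact hB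
  have ha1 : (1 : ℝ) ≤ (3 : ℝ) / 2 - η₀ := by linarith
  have hchain : ((N : ℝ)) ^ 3 ≤ (N : ℝ) ^ ((2 + η₀) * ((3 : ℝ) / 2 - η₀)) :=
    calc ((N : ℝ)) ^ 3 ≤ (B : ℝ) * (Fintype.card G : ℝ) ^ ((3 : ℝ) / 2 - η₀) := hsum
      _ ≤ (B : ℝ) ^ ((3 : ℝ) / 2 - η₀) * (Fintype.card G : ℝ) ^ ((3 : ℝ) / 2 - η₀) :=
          mul_le_mul_of_nonneg_right (Real.self_le_rpow_of_one_le hB1' ha1) (by positivity)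
      _ = ((B : ℝ) * (Fintype.card G : ℝ)) ^ ((3 : ℝ) / 2 - η₀) :=
          (Real.mul_rpow (by positivity) (by positivity)).symm
      _ ≤ ((N : ℝ) ^ (2 + η₀)) ^ ((3 : ℝ) / 2 - η₀) :=
          Real.rpow_le_rpow (by positivity) hBG (by linarith)
      _ = (N : ℝ) ^ ((2 + η₀) * ((3 : ℝ) / 2 - η₀)) := (Real.rpow_mul (by positivity) _ _).symm
  have hexp : (2 + η₀) * ((3 : ℝ) / 2 - η₀) < 3 := by nlinarith
  have hlt : (N : ℝ) ^ ((2 + η₀) * ((3 : ℝ) / 2 - η₀)) < (N : ℝ) ^ (3 : ℝ) :=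
    Real.rpow_lt_rpow_of_exponent_lt hN1 hexp
  rw [Real.rpow_ofNat] at hlt
  exact absurd (hchain.trans_lt hlt) (lt_irrefl _)

end Summit.MatrixMultiplication.MatrixMultiplication.Theorems
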